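import Summits.BirchSwinnertonDyer.BirchSwinnertonDyer.Theorems.ThetaPartnerAtTwoSignedControlAtTwoH1SigmaCorankBound
import Literature.NumberTheory.EllipticCurves.CongruenceVisibilityLocalFactors
import HarnessLib

/-!
# Greenberg, LNM 1716, pp. 119–120 for EVERY number field: `corank_{ℤ_p} H¹(K_Σ/K, E[p^∞]) ≤ [K:ℚ]` when `Sel_{p^∞}(E/K)`
# is finite — the named fact `Greenberg1999.h1Sigma_zpCorank_le_degree K` DISCHARGED for all `K : Type`

Crux K4 `SignedControlAtTwo` (stmt-BirchSwinnertonDyer-20309), line `eulerchar`; width seat `prover-bsd-wall-tp2-p3-w3` g4. Sequel to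
`…H1SigmaCorankBound.lean` (the case `K = ℚ`, which is what the K4 stub consumes): the same assembly over an arbitrary number field,
the only new input being the local degree count «the `ℤ_p`-corank of `𝒫_E^Σ(F)` is equal to `[F:ℚ]`» in the form
`∏_{v ∈ Σ_f} #(𝓞_v/p^k) = p^{k·[K:ℚ]}` — from the tree's `prod_natCard_quot_adicCompletionIntegers` (`∏_{v ∣ p} #(𝓞_v/p) = p^{[K:ℚ]}`,
Neukirch II (8.4)) and `#(𝓞_v/p^k) = #(𝓞_v/p)^k`.

* `natCard_quot_adicCompletionIntegers_pow` — `#(𝓞_v/p^k) = #(𝓞_v/p)^k`;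
* `zpCorank_unramifiedOutside_top_le_finrank` — `zpCorank (unramifiedOutside ⊤ E[p^∞] p S₀) p ≤ [K:ℚ]` (`Sel_{p^∞}(E/K)` finite);
* **`h1Sigma_zpCorank_le_degree_numberField K : Greenberg1999.h1Sigma_zpCorank_le_degree K`** for every number field `K : Type`.

THEOREMS ONLY (no definition, no named fact, no `sorry`); nothing about any particular curve is asserted; BSD is not proved by
any of this.

References: [GreenbergLNM1716] §4 Appendix pp. 119–120, §2 pp. 74, 78; [MilneADT2006] I Thm. 2.8, Lemma 3.3, Cor. 3.4, Prop. 3.8;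
[NeukirchANT1999] Ch. II (8.4).
-/

set_option autoImplicit false
-- the Theorems namespace of this sub repeats the summit name by design (D-0017 nested layout)
set_option linter.dupNamespace false

noncomputable section

open scoped Classical NumberField AddSubgroup

namespace Summit.BirchSwinnertonDyer.BirchSwinnertonDyer.Theorems.SignedEC.H1SigmaCorank

open NumberField IsDedekindDomain Field WeierstrassCurve
open Literature.NumberTheory.EllipticCurves Literature.NumberTheory.GaloisRepresentations
  Literature.NumberTheory.EllipticCurves.GreenbergVatsal2000
open Summit.BirchSwinnertonDyer.Rank1Residual.GaloisImage

variable {K : Type} [Field K] [NumberField K]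

omit [NumberField K] in
/-- `#(𝓞_v / p^k 𝓞_v) = #(𝓞_v / p 𝓞_v)^k` (`p ≠ 0`; iterate `#(R/(ab)) = #(R/(a)) · #(R/(b))`). [folklore] -/
theorem natCard_quot_adicCompletionIntegers_pow [NumberField K] (v : HeightOneSpectrum (𝓞 K)) {p : ℕ} (hp : p ≠ 0) (k : ℕ) :
    Nat.card (v.adicCompletionIntegers K ⧸ Ideal.span {((p ^ k : ℕ) : v.adicCompletionIntegers K)}) =
      Nat.card (v.adicCompletionIntegers K ⧸ Ideal.span {((p : ℕ) : v.adicCompletionIntegers K)}) ^ k := by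
  induction k with
  | zero =>
    rw [pow_zero, pow_zero, Nat.cast_one, Ideal.span_singleton_one]
    haveI : Subsingleton (v.adicCompletionIntegers K ⧸ (⊤ : Ideal (v.adicCompletionIntegers K))) :=
      Ideal.Quotient.subsingleton_iff.mpr rfl
    exact Nat.card_of_subsingleton 0
  | succ k ih =>
    rw [pow_succ, Nat.cast_mul, natCard_quotient_span_singleton_mul' (LocalPoints.natCast_ne_zero v (pow_ne_zero k hp)),
      ih, pow_succ]

variable (W : WeierstrassCurve K) [W.IsElliptic] (p : ℕ) [hp : Fact p.Prime]

/-- **`corank_{ℤ_p} H¹(K_Σ/K, E[p^∞]) ≤ [K:ℚ]` when `Sel_{p^∞}(E/K)` is finite**, every number field `K` (Greenberg, LNM 1716,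
pp. 119–120): for `S₀` finite with good reduction off `S₀ ∪ {v ∣ p}`, `zpCorank (unramifiedOutside ⊤ E[p^∞] p S₀) p ≤ [K:ℚ]`.
Same assembly as `zpCorank_unramifiedOutside_top_le_one` with `∏_{v ∈ Σ_f} #(𝓞_v/p^k) = p^{k·[K:ℚ]}`.
[cite: GreenbergLNM1716, §4 Appendix pp. 119–120; §2 pp. 74, 78] [cite: MilneADT2006, I Cor. 3.4, Prop. 3.8] [cite: NeukirchANT1999, Ch. II (8.4)] -/
theorem zpCorank_unramifiedOutside_top_le_finrank [Finite (W.selmerGroupPInfty p)]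
    {S₀ : Set (HeightOneSpectrum (𝓞 K))} (hS₀ : S₀.Finite)
    (hgood : ∀ v : HeightOneSpectrum (𝓞 K), v ∉ S₀ → ((p : ℕ) : 𝓞 K) ∉ v.asIdeal → W.HasGoodReductionAt v) :
    zpCorank ↥(unramifiedOutside (⊤ : Subgroup (absoluteGaloisGroup K)) (W.geomPrimaryTorsion p) p S₀) p ≤
      Module.finrank ℚ K := by
  set U : AddSubgroup (W.subgroupH1 p (⊤ : Subgroup (absoluteGaloisGroup K))) :=
    unramifiedOutside (⊤ : Subgroup (absoluteGaloisGroup K)) (W.geomPrimaryTorsion p) p S₀ with hU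
  -- `Σ_f = S₀ ∪ {v ∣ p}`
  have hSp : {v : HeightOneSpectrum (𝓞 K) | ((p : ℕ) : 𝓞 K) ∈ v.asIdeal}.Finite := by
    have h := finite_setOf_intCast_mem_asIdeal (K := K) (n := (p : ℤ)) (by exact_mod_cast hp.out.ne_zero)
    simpa only [Int.cast_natCast] using h
  set S : Finset (HeightOneSpectrum (𝓞 K)) := (hS₀.union hSp).toFinset with hS
  have hmemS : ∀ v, v ∈ S ↔ v ∈ S₀ ∨ ((p : ℕ) : 𝓞 K) ∈ v.asIdeal := fun v ↦ by
    rw [hS, Set.Finite.mem_toFinset, Set.mem_union, Set.mem_setOf_eq]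
  -- local targets and `Φ`
  let D : S → Type := fun v ↦
    discreteH1 (localSubgroup (⊤ : Subgroup (absoluteGaloisGroup K)) ((v : HeightOneSpectrum (𝓞 K)).adicCompletion K))
      (localPoints W ((v : HeightOneSpectrum (𝓞 K)).adicCompletion K))
  let D' : InfinitePlace K → Type := fun w ↦
    discreteH1 (localSubgroup (⊤ : Subgroup (absoluteGaloisGroup K)) w.Completion) (localPoints W w.Completion)
  let Φf : W.subgroupH1 p (⊤ : Subgroup (absoluteGaloisGroup K)) →+ (Π v : S, D v) :=
    AddMonoidHom.pi fun v ↦ W.localResOver p ⊤ ((v : HeightOneSpectrum (𝓞 K)).adicCompletion K)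
  let Φi : W.subgroupH1 p (⊤ : Subgroup (absoluteGaloisGroup K)) →+ (Π w : InfinitePlace K, D' w) :=
    AddMonoidHom.pi fun w ↦ W.localResOver p ⊤ w.Completion
  let Φ : U →+ (Π v : S, D v) × (Π w : InfinitePlace K, D' w) := (Φf.prod Φi).comp U.subtype
  -- (K) kernel finite
  haveI : Finite (W.selmerGroupOver p (⊤ : Subgroup (absoluteGaloisGroup K))) := finite_selmerGroupOver_top W p
  have hkerinj : Function.Injective (fun x : Φ.ker ↦
      (⟨((x : U) : W.subgroupH1 p ⊤), by
        have hx := x.2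
        rw [AddMonoidHom.mem_ker] at hx
        refine mem_selmerGroupOver_top_of_mem_unramifiedOutside W p hgood _ (x : U).2 (fun v hv ↦ ?_) (fun w ↦ ?_)
        · exact congrArg (fun t : (Π v : S, D v) × (Π w : InfinitePlace K, D' w) ↦ t.1 ⟨v, (hmemS v).2 hv⟩) hx
        · exact congrArg (fun t : (Π v : S, D v) × (Π w : InfinitePlace K, D' w) ↦ t.2 w) hx⟩ :
        W.selmerGroupOver p (⊤ : Subgroup (absoluteGaloisGroup K)))) := by
    intro x y hxy
    exact Subtype.ext (Subtype.ext (congrArg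
      (fun z : W.selmerGroupOver p (⊤ : Subgroup (absoluteGaloisGroup K)) ↦ (z : W.subgroupH1 p ⊤)) hxy))
  haveI hker : Finite Φ.ker := Finite.of_injective _ hkerinj
  -- (L) local bounds
  choose B hBpos hB using fun v : S ↦
    exists_natCard_torsionBy_localSubgroup_top_le W (v : HeightOneSpectrum (𝓞 K)) p
  choose B' hB'pos hB' using fun w : InfinitePlace K ↦
    exists_natCard_torsionBy_localSubgroup_top_le_infinitePlace W w p
  -- `∏_{v ∈ Σ_f} #(𝓞_v/p^k) = p^{k [K:ℚ]}`
  have hprodq : ∀ k : ℕ, ∏ v : S, Nat.card ((v : HeightOneSpectrum (𝓞 K)).adicCompletionIntegers K ⧸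
      Ideal.span {((p ^ k : ℕ) : (v : HeightOneSpectrum (𝓞 K)).adicCompletionIntegers K)}) =
        p ^ (Module.finrank ℚ K * k) := by
    intro k
    have h1 : ∏ v ∈ S, Nat.card (v.adicCompletionIntegers K ⧸ Ideal.span {((p : ℕ) : v.adicCompletionIntegers K)}) =
        p ^ Module.finrank ℚ K :=
      prod_natCard_quot_adicCompletionIntegers (K := K) (p := p) S fun v hv hpv ↦ hv ((hmemS v).2 (Or.inr hpv))
    rw [Finset.prod_coe_sort S (fun v ↦ Nat.card (v.adicCompletionIntegers K ⧸
      Ideal.span {((p ^ k : ℕ) : v.adicCompletionIntegers K)})),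
      Finset.prod_congr rfl fun v _ ↦ natCard_quot_adicCompletionIntegers_pow v hp.out.ne_zero k,
      Finset.prod_pow, h1, ← pow_mul]
  -- `U` is `p`-primary
  have hprim : ∀ u : U, ∃ n : ℕ, p ^ n • u = 0 := fun u ↦ by
    obtain ⟨n, hn⟩ := exists_pow_smul_eq_zero_subgroupH1_top W p (u : W.subgroupH1 p ⊤)
    exact ⟨n, Subtype.ext (by rw [AddSubgroupClass.coe_nsmul, hn]; rfl)⟩
  -- growth bound
  have hcount : ∀ k : ℕ, Finite (U[((p ^ k : ℕ) : ℤ)]) ∧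
      Nat.card (U[((p ^ k : ℕ) : ℤ)]) ≤
        (Nat.card Φ.ker * ((∏ v : S, B v) * ∏ w : InfinitePlace K, B' w)) * p ^ (Module.finrank ℚ K * k) := by
    intro k
    haveI : ∀ v : S, Finite ((D v)[((p ^ k : ℕ) : ℤ)]) := fun v ↦ (hB v k).1
    haveI : ∀ w : InfinitePlace K, Finite ((D' w)[((p ^ k : ℕ) : ℤ)]) := fun w ↦ (hB' w k).1
    obtain ⟨hTf, hTfcard⟩ := finite_and_natCard_torsionBy_pi D ((p ^ k : ℕ) : ℤ)
    obtain ⟨hTi, hTicard⟩ := finite_and_natCard_torsionBy_pi D' ((p ^ k : ℕ) : ℤ)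
    haveI := hTf
    haveI := hTi
    obtain ⟨hT, hTcard⟩ := finite_and_natCard_torsionBy_prod (Π v : S, D v) (Π w : InfinitePlace K, D' w) ((p ^ k : ℕ) : ℤ)
    haveI := hT
    obtain ⟨hUfin, hUle⟩ := finite_and_natCard_torsionBy_le_of_finite_ker Φ ((p ^ k : ℕ) : ℤ)
    refine ⟨hUfin, hUle.trans ?_⟩
    have hf : ∏ v : S, Nat.card ((D v)[((p ^ k : ℕ) : ℤ)]) ≤ (∏ v : S, B v) * p ^ (Module.finrank ℚ K * k) := by
      rw [← hprodq k, ← Finset.prod_mul_distrib]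
      exact Finset.prod_le_prod (fun v _ ↦ Nat.zero_le _) fun v _ ↦ (hB v k).2
    have hi : ∏ w : InfinitePlace K, Nat.card ((D' w)[((p ^ k : ℕ) : ℤ)]) ≤ ∏ w : InfinitePlace K, B' w :=
      Finset.prod_le_prod (fun w _ ↦ Nat.zero_le _) fun w _ ↦ (hB' w k).2
    rw [hTcard, hTfcard, hTicard]
    calc Nat.card Φ.ker * ((∏ v : S, Nat.card ((D v)[((p ^ k : ℕ) : ℤ)])) *
          ∏ w : InfinitePlace K, Nat.card ((D' w)[((p ^ k : ℕ) : ℤ)]))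
        ≤ Nat.card Φ.ker * (((∏ v : S, B v) * p ^ (Module.finrank ℚ K * k)) * ∏ w : InfinitePlace K, B' w) :=
          Nat.mul_le_mul_left _ (Nat.mul_le_mul hf hi)
      _ = (Nat.card Φ.ker * ((∏ v : S, B v) * ∏ w : InfinitePlace K, B' w)) * p ^ (Module.finrank ℚ K * k) := by ring
  haveI : Finite (U[(p : ℤ)]) := by
    have h := (hcount 1).1
    simpa only [pow_one] using h
  exact zpCorank_le_of_natCard_torsionBy_pow_le hprim fun k ↦ (hcount k).2

/-- **Greenberg, LNM 1716 (1999), §4 Appendix pp. 119–120 — the named fact `Greenberg1999.h1Sigma_zpCorank_le_degree K` HOLDS for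
every number field `K`** (`K : Type`): for every elliptic curve `E/K`, every prime `p` with `Sel_{p^∞}(E/K)` finite and every finite
`S₀` with good reduction off `S₀ ∪ {v ∣ p}`, `corank_{ℤ_p} H¹(K_Σ/K, E[p^∞]) ≤ [K:ℚ]`.
[cite: GreenbergLNM1716, §4 Appendix pp. 119–120 (held copy chunk p0119 last display, chunk p0120 L1); §2 pp. 74, 78]
[cite: MilneADT2006, I Thm. 2.8, Lemma 3.3, Cor. 3.4, Prop. 3.8] [cite: NeukirchANT1999, Ch. II (8.4)] -/
theorem h1Sigma_zpCorank_le_degree_numberField (K : Type) [Field K] [NumberField K] :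
    Greenberg1999.h1Sigma_zpCorank_le_degree K := by
  intro W _ p _ hSel S₀ hS₀ hgood
  haveI := hSel
  exact zpCorank_unramifiedOutside_top_le_finrank W p hS₀ hgood

end Summit.BirchSwinnertonDyer.BirchSwinnertonDyer.Theorems.SignedEC.H1SigmaCorank

end
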